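import Literature.AlgebraicGeometry.Motives.VeryGeneralComplexPoint
import Literature.AlgebraicGeometry.Motives.FlatOverSmoothCurve
import Literature.AlgebraicGeometry.HodgeTheory.CurvePoleSpaces
import HarnessLib

/-!
# The image of the complex points of a non-empty open under a morphism not crushing the generic point is uncountable

Topic `Literature/AlgebraicGeometry/Motives` (family `hodge`). Theorems only (no definition, no
named fact; D-0026). A corollary of the tree's "very general point" device
(`ComplexPoints.exists_mem_mem_forall_pt_not_mem`, `VeryGeneralComplexPoint.lean`: countably many
proper Zariski-closed subsets of an irreducible `T` do not cover the complex points of a non-empty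
open of `T` — Baire on the locally compact Hausdorff `T(ℂ)`; Voisin, *Hodge Theory II*, §3.3.1;
Arapura 2022, proof of Cor. 1.5 "Since `C` is a countable union of proper subvarieties
`U - C ≠ ∅`"):

* `ComplexPoints.not_countable_image_of_base_genericPoint_ne` — for a morphism `h : T ⟶ S` of
  `ℂ`-schemes with `T` irreducible, separated and locally of finite type, a non-empty (on complex
  points) open `O ⊆ T`, if the generic point of `T` is not mapped to the point of any complex point
  of `S` (e.g. `h` dominant onto a positive-dimensional irreducible `S`), then
  **the set `h(O(ℂ)) ⊆ S(ℂ)` is NOT countable**: otherwise `O(ℂ)` would be covered by the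
  complex points of the countably many proper closed fibres `h⁻¹(u)`, `u ∈ h(O(ℂ))`;
* `ComplexPoints.not_countable_image_of_isDominant_of_smoothCurve` — the case of a dominant `h`
  onto a smooth integral CURVE `S` (a complex point of a smooth curve is not its generic point,
  `HodgeTheory.pt_ne_genericPoint`).

Consumer: step S5 of stub `GenericPropagation` of the crux line `padic-disc-transport`
(`Summits/HodgeConjecture/HodgeConjecture/Cruxes/VariationalHodge`): algebraicity over the complex
points of a trivialising open `O` of a parameter variety `T₀ → S₀` dominating the curve gives
uncountably many algebraic fibres, hence all (`AlgebraicityLocusCurveBaseDichotomy`).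

## References

* [VoisinHodgeII2003] C. Voisin, Hodge Theory and Complex Algebraic Geometry II (2003), §3.3.1.
* [Arapura2022] D. Arapura, Hodge cycles and the Leray filtration, Pacific J. Math. 319 (2022),
  proof of Cor. 1.5.
* [Hartshorne1977] R. Hartshorne, Algebraic Geometry (1977), II Ex. 2.9, II Ex. 3.7.
-/

noncomputable section

open CategoryTheory AlgebraicGeometry Set
open _root_.Topology

namespace Literature.AlgebraicGeometry.Motives.ComplexPoints

variable {T S : SchemeOver ℂ} (h : T ⟶ S)

/-- **The image of `O(ℂ)` under a morphism not crushing the generic point is uncountable.** Let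
`h : T ⟶ S` be a morphism of `ℂ`-schemes, `T` irreducible, separated and locally of finite type
over `ℂ`, `O ⊆ T` an open containing (the point of) a complex point, and suppose the generic point
of `T` is not mapped to the point of any complex point of `S`. Then `{h(x) | x ∈ T(ℂ), pt(x) ∈ O}`
is not countable: if it were, the closed subsets `T ∖ O` and `h⁻¹(pt u)`, `u` in the image, would
be countably many PROPER closed subsets (the fibres miss the generic point) covering `T(ℂ)` —
against the very general point (`exists_mem_mem_forall_pt_not_mem`, Baire).
[cite: VoisinHodgeII2003, §3.3.1] [cite: Arapura2022, proof of Cor. 1.5] -/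
theorem not_countable_image_of_base_genericPoint_ne [IsSeparated T.hom] [LocallyOfFiniteType T.hom]
    [IrreducibleSpace T.left] (hgen : ∀ u : ComplexPoints S, h.left.base (genericPoint T.left) ≠ u.pt)
    (O : T.left.Opens) (hO : ∃ x : ComplexPoints T, x.pt ∈ O) :
    ¬ {u : ComplexPoints S | ∃ x : ComplexPoints T, x.pt ∈ O ∧ AlgPoints.map h x = u}.Countable := by
  intro hc
  set G : Set (ComplexPoints S) :=
    {u : ComplexPoints S | ∃ x : ComplexPoints T, x.pt ∈ O ∧ AlgPoints.map h x = u} with hG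
  -- the countable family of proper closed subsets: `T ∖ O` and the fibres over the image
  let C : Option G → Set T.left := fun o =>
    match o with
    | none => (O : Set T.left)ᶜ
    | some u => h.left.base ⁻¹' {(u : ComplexPoints S).pt}
  haveI : Countable G := hc.to_subtype
  have hCc : ∀ o, IsClosed (C o) := by
    rintro (_ | u)
    · exact O.isOpen.isClosed_compl
    · exact (ComplexPoints.isClosed_pt (u : ComplexPoints S)).preimage h.left.continuous
  have hCne : ∀ o, C o ≠ univ := by
    rintro (_ | u)
    · obtain ⟨x, hx⟩ := hO
      intro hU
      have : x.pt ∈ ((O : Set T.left)ᶜ) := by rw [show ((O : Set T.left)ᶜ) = univ from hU]; trivial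
      exact this hx
    · intro hU
      apply hgen (u : ComplexPoints S)
      have : genericPoint T.left ∈ h.left.base ⁻¹' {(u : ComplexPoints S).pt} := by
        rw [show h.left.base ⁻¹' {(u : ComplexPoints S).pt} = univ from hU]; trivial
      exact this
  obtain ⟨P, -, hPO, hP⟩ :=
    exists_mem_mem_forall_pt_not_mem hCc hCne O isOpen_univ (by
      obtain ⟨x, hx⟩ := hO
      exact ⟨x, mem_univ _, hx⟩)
  -- `h(P)` lies in the image, and `P` in its fibre
  have hmem : AlgPoints.map h P ∈ G := ⟨P, hPO, rfl⟩
  have hfib := hP (some ⟨AlgPoints.map h P, hmem⟩)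
  exact hfib (by
    change h.left.base P.pt ∈ ({(AlgPoints.map h P).pt} : Set S.left)
    rw [AlgPoints.pt_map]
    rfl)

/-- **Dominant onto a smooth curve: the image of `O(ℂ)` is uncountable.** For `h : T ⟶ S`
dominant with `T` irreducible, separated and locally of finite type over `ℂ` and `S` a smooth
integral curve, and an open `O ⊆ T` with a complex point, `h(O(ℂ))` is not countable: the generic
point of `T` goes to the generic point of `S` (`genericPoint_eq_of_isDominant'`), which is not the
point of a complex point (`HodgeTheory.pt_ne_genericPoint`). [cite: VoisinHodgeII2003, §3.3.1]
[cite: Arapura2022, proof of Cor. 1.5] -/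
theorem not_countable_image_of_isDominant_of_smoothCurve [IsSeparated T.hom]
    [LocallyOfFiniteType T.hom] [IrreducibleSpace T.left] [IsIntegral S.left]
    [SmoothOfRelativeDimension 1 S.hom] [IsDominant h.left] (O : T.left.Opens)
    (hO : ∃ x : ComplexPoints T, x.pt ∈ O) :
    ¬ {u : ComplexPoints S | ∃ x : ComplexPoints T, x.pt ∈ O ∧ AlgPoints.map h x = u}.Countable := by
  refine not_countable_image_of_base_genericPoint_ne h (fun u => ?_) O hO
  rw [genericPoint_eq_of_isDominant' h.left]
  exact (HodgeTheory.pt_ne_genericPoint S u).symm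

end Literature.AlgebraicGeometry.Motives.ComplexPoints

end
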